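import Literature.Analysis.FluidPDE.PassiveScalarDiagEnergyContinuityGlobal
import HarnessLib

/-!
# The Duhamel (`L¹_t L²_x` source) bound for `C([0,T]; L²)` weak passive scalars with constant
# diagonal diffusion and bounded drift: `‖θ(t₂)‖_{L²} ≤ ‖θ(t₁)‖_{L²} + ∫_{t₁}^{t₂} ‖s(τ)‖_{L²} dτ`

Analysis/FluidPDE proof file (everything proved; no definitions, no named facts). For `κ > 0`,
`aᵢ > 0`, `θ₀ ∈ L²(T^d)`, `u ∈ L^∞((0,T) × T^d)` (weakly divergence free for a.e. `t`, part of the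
class), `∫₀ᵀ ‖s(t)‖_{L²} dt < ∞`, and an `L²`-CONTINUOUS weak solution `θ` of
`∂ₜθ + u·∇θ = κ ∑ᵢ aᵢ ∂ᵢ∂ᵢθ + s` on `T^d × [0,T)` (`Torus.IsWeakScalarTransportDiagForcedOn` with
`Torus.IsL2ContinuousOn (Icc 0 T) θ` — every weak solution is one after modification on a null set of
times, `PassiveScalarDiagEnergyContinuity`):

* `IsWeakScalarTransportDiagForcedOn.sqrt_integral_sq_le_of_isL2ContinuousOn` — for all
  `0 ≤ t₁ ≤ t₂ ≤ T`, `‖θ(t₂)‖_{L²} ≤ ‖θ(t₁)‖_{L²} + ∫_{t₁}^{t₂} ‖s(τ)‖_{L²} dτ` (the `L²` bound of the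
  mild / Duhamel formula for a contraction evolution, Pazy 1983, Ch. 4 §4.2 (2.3): the transport–
  diffusion evolution is an `L²`-contraction and the source is integrated in time), and the datum
  form `‖θ(t)‖_{L²} ≤ ‖θ₀‖_{L²} + ∫₀ᵗ ‖s‖_{L²}` (`….sqrt_integral_sq_le_datum_of_isL2ContinuousOn`);
* `IsWeakScalarTransportDiagForced.sqrt_integral_sq_le_of_isL2ContinuousOn` — the same for global
  `C([0,∞); L²)` solutions and all `0 ≤ t₁ ≤ t₂`.

Proof: from the energy equality between every pair of times
(`energy_eq_sub_of_isL2ContinuousOn`) and Cauchy–Schwarz, `E = ‖θ(·)‖²` is continuous on `[0,T]`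
and satisfies `E(b) ≤ E(a) + 2∫ₐᵇ g √E` with `g = ‖s(·)‖_{L²} ∈ L¹`; an elementary first-crossing
comparison argument (`sqrt_le_sqrt_add_integral`: compare `√E` with
`√E(t₁) + ε + (1+ε)∫_{t₁}^{t} g` and let `ε → 0`) gives `√E(t₂) ≤ √E(t₁) + ∫_{t₁}^{t₂} g` — the
integrated form of `d/dt √E ≤ g`, without differentiating.

## References

* A. Pazy, *Semigroups of Linear Operators and Applications to PDE* (Springer 1983), Ch. 4 §4.2,
  (2.3) and Cor. 2.2 (mild solutions of the inhomogeneous problem). [`Pazy1983`]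
* P. Bonicatto, G. Ciampa, G. Crippa, J. Evol. Equ. 24 (2024), Thm. 3.3, (3.4), Remark 3.4.
  [`BonicattoCiampaCrippa2023`]
* T. D. Drivas, T. M. Elgindi, G. Iyer, I.-J. Jeong, ARMA 243 (2022), (1.1)–(1.3). [`DEIJ2022`]
-/

noncomputable section

open _root_.MeasureTheory _root_.Set _root_.Filter _root_.Function _root_.TopologicalSpace
open scoped ENNReal NNReal InnerProductSpace ContDiff Topology
open Literature.Analysis.FunctionSpaces.Torus Literature.Analysis.FunctionSpaces UnitAddTorus

namespace Literature.Analysis.FluidPDE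

variable {d : Type*} [Fintype d] [DecidableEq d]

/-! ## The comparison lemma: `E(b) ≤ E(a) + 2∫ₐᵇ g√E` gives `√E(t) ≤ √E(a₀) + ∫ g` -/

section Comparison

omit [Fintype d] [DecidableEq d] in
/-- **Integrated square-root comparison.** Let `E ≥ 0` be continuous on `[a₀, b₀]`, `g ≥ 0`
integrable on `[a₀, b₀]`, and `E(b) ≤ E(a) + 2 ∫_{(a,b]} g √E` for all `a₀ ≤ a ≤ b ≤ b₀`. Then
`√E(t) ≤ √E(a₀) + ∫_{(a₀,t]} g` for every `t ∈ [a₀, b₀]` (the integrated form of `(√E)' ≤ g`;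
proof by a first-crossing argument against `√E(a₀) + ε + (1+ε) ∫ g`, then `ε → 0`). [folklore] -/
private theorem sqrt_le_sqrt_add_integral {a₀ b₀ : ℝ} {E g : ℝ → ℝ}
    (hE : ContinuousOn E (Icc a₀ b₀)) (hE0 : ∀ t ∈ Icc a₀ b₀, 0 ≤ E t)
    (hg : IntegrableOn g (Icc a₀ b₀) volume) (hg0 : ∀ τ, 0 ≤ g τ)
    (hineq : ∀ ⦃a b : ℝ⦄, a₀ ≤ a → a ≤ b → b ≤ b₀ →
      E b ≤ E a + 2 * ∫ τ in Ioc a b, g τ * Real.sqrt (E τ)) :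
    ∀ t ∈ Icc a₀ b₀, Real.sqrt (E t) ≤ Real.sqrt (E a₀) + ∫ τ in Ioc a₀ t, g τ := by
  -- the primitive `G` of `g`
  set G : ℝ → ℝ := fun t => ∫ τ in Ioc a₀ t, g τ with hG
  have hGc : ContinuousOn G (Icc a₀ b₀) := intervalIntegral.continuousOn_primitive hg
  have hGa₀ : G a₀ = 0 := by simp [hG]
  have hGnn : ∀ t, 0 ≤ G t := fun t => setIntegral_nonneg measurableSet_Ioc fun τ _ => hg0 τ
  have hGmono : ∀ {t t' : ℝ}, t ≤ t' → t' ≤ b₀ → G t ≤ G t' := fun {t t'} htt' ht' =>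
    setIntegral_mono_set (hg.mono_set (Ioc_subset_Icc_self.trans (Icc_subset_Icc le_rfl ht')))
      (ae_of_all _ fun τ => hg0 τ) (Ioc_subset_Ioc le_rfl htt').eventuallyLE
  have hGsub : ∀ {t t' : ℝ}, a₀ ≤ t → t ≤ t' → t' ≤ b₀ → G t' - G t = ∫ τ in Ioc t t', g τ := by
    intro t t' ht htt' ht'
    have hi₁ : IntervalIntegrable g volume a₀ t' :=
      (intervalIntegrable_iff_integrableOn_Ioc_of_le (ht.trans htt')).2
        (hg.mono_set (Ioc_subset_Icc_self.trans (Icc_subset_Icc le_rfl ht')))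
    have hi₂ : IntervalIntegrable g volume a₀ t :=
      (intervalIntegrable_iff_integrableOn_Ioc_of_le ht).2
        (hg.mono_set (Ioc_subset_Icc_self.trans (Icc_subset_Icc le_rfl (htt'.trans ht'))))
    simp only [hG]
    rw [← intervalIntegral.integral_of_le (ht.trans htt'), ← intervalIntegral.integral_of_le ht,
      ← intervalIntegral.integral_of_le htt', intervalIntegral.integral_interval_sub_left hi₁ hi₂]
  -- the claim with an `ε` of room
  have claim : ∀ ε : ℝ, 0 < ε → ∀ t ∈ Icc a₀ b₀,
      Real.sqrt (E t) ≤ Real.sqrt (E a₀) + ε + (1 + ε) * G t := by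
    intro ε hε
    by_contra hcon
    push Not at hcon
    obtain ⟨t₀, ht₀, hlt⟩ := hcon
    set H : ℝ → ℝ := fun t => Real.sqrt (E a₀) + ε + (1 + ε) * G t with hH
    have hHc : ContinuousOn H (Icc a₀ b₀) := continuousOn_const.add (continuousOn_const.mul hGc)
    have hHpos : ∀ t, 0 < H t := fun t => by
      have := hGnn t
      have := Real.sqrt_nonneg (E a₀)
      simp only [hH]
      nlinarith
    have hHmono : ∀ {t t' : ℝ}, t ≤ t' → t' ≤ b₀ → H t ≤ H t' := fun {t t'} htt' ht' => by
      simp only [hH]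
      nlinarith [hGmono htt' ht']
    -- the crossing set and its infimum
    set C : Set ℝ := Icc a₀ b₀ ∩ (fun t => Real.sqrt (E t) - H t) ⁻¹' Ici 0 with hCdef
    have hCcl : IsClosed C :=
      ((Real.continuous_sqrt.comp_continuousOn hE).sub hHc).preimage_isClosed_of_isClosed
        isClosed_Icc isClosed_Ici
    have ht₀C : t₀ ∈ C := ⟨ht₀, sub_nonneg.2 hlt.le⟩
    have hCne : C.Nonempty := ⟨t₀, ht₀C⟩
    have hCbdd : BddBelow C := ⟨a₀, fun t ht => ht.1.1⟩
    set tS : ℝ := sInf C with htS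
    have htSC : tS ∈ C := hCcl.csInf_mem hCne hCbdd
    have htSI : tS ∈ Icc a₀ b₀ := htSC.1
    have hHS : H tS ≤ Real.sqrt (E tS) := sub_nonneg.1 htSC.2
    have ha₀C : a₀ ∉ C := by
      rintro ⟨-, h0⟩
      have h1 : H a₀ ≤ Real.sqrt (E a₀) := sub_nonneg.1 h0
      simp only [hH, hGa₀, mul_zero, add_zero] at h1
      linarith
    have ha₀tS : a₀ < tS := lt_of_le_of_ne htSI.1 fun h0 => ha₀C (by rw [h0]; exact htSC)
    have hbelow : ∀ τ, a₀ ≤ τ → τ < tS → Real.sqrt (E τ) < H τ := by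
      intro τ h1 h2
      by_contra hn
      push Not at hn
      have hτC : τ ∈ C := ⟨⟨h1, h2.le.trans htSI.2⟩, sub_nonneg.2 hn⟩
      exact (not_le.2 h2) (csInf_le hCbdd hτC)
    -- a time `t'` just before `tS` where `H` is already close to `H tS`
    set c : ℝ := (1 - ε) / (1 + ε) * H tS with hc
    have hc_lt : c < H tS := by
      have h1 : (1 - ε) / (1 + ε) < 1 := by rw [div_lt_one (by linarith)]; linarith
      have h2 := mul_lt_mul_of_pos_right h1 (hHpos tS)
      rwa [one_mul] at h2
    obtain ⟨δ, hδ, hδH⟩ := Metric.continuousWithinAt_iff.1 (hHc tS htSI) (H tS - c) (by linarith)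
    set t' : ℝ := max a₀ (tS - δ / 2) with ht'
    have ht'a₀ : a₀ ≤ t' := le_max_left _ _
    have ht'lt : t' < tS := max_lt ha₀tS (by linarith)
    have ht'I : t' ∈ Icc a₀ b₀ := ⟨ht'a₀, ht'lt.le.trans htSI.2⟩
    have hdist : dist t' tS < δ := by
      rw [Real.dist_eq, abs_sub_comm, abs_of_nonneg (by linarith)]
      have : tS - δ / 2 ≤ t' := le_max_right _ _
      linarith
    have hHt' : c < H t' := by
      have h1 := hδH ht'I hdist
      rw [Real.dist_eq] at h1
      have h2 := (abs_lt.1 h1).1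
      linarith
    -- the energy inequality on `[t', tS]`, with `√E < H ≤ H tS` inside
    have hEin := hineq ht'a₀ ht'lt.le htSI.2
    have hInt : ∫ τ in Ioc t' tS, g τ * Real.sqrt (E τ) ≤ H tS * ∫ τ in Ioc t' tS, g τ := by
      rw [← setIntegral_congr_set (Ioo_ae_eq_Ioc (μ := (volume : Measure ℝ)) (a := t') (b := tS)),
        ← setIntegral_congr_set (Ioo_ae_eq_Ioc (μ := (volume : Measure ℝ)) (a := t') (b := tS)),
        ← integral_const_mul]
      refine integral_mono_of_nonneg (ae_of_all _ fun τ => mul_nonneg (hg0 τ) (Real.sqrt_nonneg _))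
        ((hg.mono_set (Ioo_subset_Icc_self.trans (Icc_subset_Icc ht'a₀ htSI.2))).const_mul _) ?_
      refine (ae_restrict_iff' measurableSet_Ioo).2 (ae_of_all _ fun τ hτ => ?_)
      have h1 := hbelow τ (ht'a₀.trans hτ.1.le) hτ.2
      have h2 := hHmono hτ.2.le htSI.2
      show g τ * Real.sqrt (E τ) ≤ H tS * g τ
      rw [mul_comm (H tS)]
      exact mul_le_mul_of_nonneg_left (h1.le.trans h2) (hg0 τ)
    have hEtS : H tS ^ 2 ≤ E tS := by
      calc H tS ^ 2 ≤ Real.sqrt (E tS) ^ 2 := pow_le_pow_left₀ (hHpos tS).le hHS 2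
        _ = E tS := Real.sq_sqrt (hE0 tS htSI)
    have hEt' : E t' < H t' ^ 2 := by
      have h1 := hbelow t' ht'a₀ ht'lt
      calc E t' = Real.sqrt (E t') ^ 2 := (Real.sq_sqrt (hE0 t' ht'I)).symm
        _ < H t' ^ 2 := pow_lt_pow_left₀ h1 (Real.sqrt_nonneg _) two_ne_zero
    have hΔ : H t' = H tS - (1 + ε) * (G tS - G t') := by simp only [hH]; ring
    have hΔG : G tS - G t' = ∫ τ in Ioc t' tS, g τ := hGsub ht'a₀ ht'lt.le htSI.2
    have hΔG0 : 0 ≤ G tS - G t' := sub_nonneg.2 (hGmono ht'lt.le htSI.2)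
    have key : H tS ^ 2 < H t' ^ 2 + 2 * (H tS * (G tS - G t')) := by
      rw [hΔG]
      linarith [hEtS, hEin, hInt, hEt']
    have h5 : (1 - ε) * H tS < (1 + ε) * H t' := by
      have e1 : c * (1 + ε) = (1 - ε) * H tS := by
        rw [hc]
        field_simp
      nlinarith [hHt', e1]
    -- contradiction: `(H tS - H t')(H tS + H t') = (1+ε)ΔG (H tS + H t') ≥ 2 H tS ΔG`
    set Δ : ℝ := G tS - G t' with hΔdef
    have hP : 0 ≤ Δ * ((1 + ε) * H t' - (1 - ε) * H tS) := mul_nonneg hΔG0 (by linarith)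
    rw [hΔ] at key hP
    nlinarith [key, hP, hHpos tS, hΔG0, hε]
  -- `ε → 0`
  intro t ht
  by_contra hcon
  push Not at hcon
  set δ : ℝ := Real.sqrt (E t) - (Real.sqrt (E a₀) + G t) with hδ
  have hδ0 : 0 < δ := by rw [hδ]; linarith
  have hGt := hGnn t
  have hε : 0 < δ / (2 * (1 + G t)) := by positivity
  have h1 := claim _ hε t ht
  have e : δ / (2 * (1 + G t)) + (1 + δ / (2 * (1 + G t))) * G t = G t + δ / 2 := by
    field_simp
    ring
  rw [add_assoc, e] at h1
  linarith

end Comparison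

namespace Torus

omit [DecidableEq d] in
/-- Cauchy–Schwarz in `L²(T^d)`: `|∫ f g| ≤ √(∫ f²) √(∫ g²)`. [folklore] -/
private theorem cs_abs_integral_mul_le {f g : UnitAddTorus d → ℝ} (hf : MemLp f 2 volume)
    (hg : MemLp g 2 volume) :
    |∫ x, f x * g x| ≤ Real.sqrt (∫ x, f x ^ 2) * Real.sqrt (∫ x, g x ^ 2) := by
  have hf' : MemLp f (ENNReal.ofReal 2) volume := by rwa [ENNReal.ofReal_ofNat]
  have hg' : MemLp g (ENNReal.ofReal 2) volume := by rwa [ENNReal.ofReal_ofNat]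
  have h := integral_mul_norm_le_Lp_mul_Lq (μ := volume) Real.HolderConjugate.two_two hf' hg'
  have e2 : ∀ (w : UnitAddTorus d → ℝ), (∫ a, ‖w a‖ ^ (2 : ℝ)) ^ (1 / (2 : ℝ)) = Real.sqrt (∫ a, w a ^ 2) := by
    intro w
    rw [Real.sqrt_eq_rpow]
    congr 1
    refine integral_congr_ae (Eventually.of_forall fun a => ?_)
    dsimp only
    rw [Real.rpow_two, Real.norm_eq_abs, sq_abs]
  rw [e2, e2] at h
  refine le_trans ?_ h
  calc |∫ x, f x * g x| ≤ ∫ x, |f x * g x| := abs_integral_le_integral_abs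
    _ = ∫ x, ‖f x‖ * ‖g x‖ := integral_congr_ae (Eventually.of_forall fun x => by
        simp [abs_mul, Real.norm_eq_abs])

namespace IsWeakScalarTransportDiagForcedOn

variable {T κ : ℝ} {a : d → ℝ} {u : ℝ → UnitAddTorus d → EuclideanSpace ℝ d} {s : ℝ → UnitAddTorus d → ℝ}
  {θ₀ : UnitAddTorus d → ℝ} {θ : ℝ → UnitAddTorus d → ℝ}

/-! ## The Duhamel bound on a finite horizon -/

/-- **`L¹_t L²_x` source bound (Duhamel) for `C([0,T]; L²)` weak passive scalars with constant
diagonal diffusion and bounded drift.** For `κ > 0`, `aᵢ > 0`, `θ₀ ∈ L²`, `u ∈ L^∞((0,T) × T^d)`,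
`∫₀ᵀ ‖s‖_{L²} < ∞`, and a weak solution `θ` of `∂ₜθ + u·∇θ = κ ∑ᵢ aᵢ ∂ᵢ∂ᵢθ + s` on `T^d × [0,T)`
which is `L²`-continuous on `[0,T]`: for all `0 ≤ t₁ ≤ t₂ ≤ T`,
`‖θ(t₂)‖_{L²} ≤ ‖θ(t₁)‖_{L²} + ∫_{t₁}^{t₂} ‖s(τ)‖_{L²} dτ`
(the `L²` estimate of the mild / Duhamel formula for a contraction evolution, Pazy 1983, Ch. 4
§4.2 (2.3); here from the energy equality, Cauchy–Schwarz and the comparison lemma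
`sqrt_le_sqrt_add_integral`). In particular the homogeneous solution map is an `L²`-contraction
and the zero-datum forced part obeys `‖θ(t)‖ ≤ ∫₀ᵗ ‖s‖`. [cite: Pazy1983, Ch. 4 §4.2 (2.3) and Cor. 2.2] -/
theorem sqrt_integral_sq_le_of_isL2ContinuousOn (h : IsWeakScalarTransportDiagForcedOn T a κ u s θ₀ θ)
    (hT : 0 < T) (hκ : 0 < κ) (ha : ∀ i, 0 < a i) (hθ₀ : MemLp θ₀ 2 volume)
    (hu : MemLp (stLift u) ⊤ (volume.restrict (Ioo 0 T ×ˢ univ)))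
    (hs : ∫⁻ t in Ioo 0 T, (∫⁻ x, ‖s t x‖ₑ ^ 2) ^ (1 / 2 : ℝ) < ⊤) (hc : IsL2ContinuousOn (Icc 0 T) θ)
    {t₁ t₂ : ℝ} (ht₁ : 0 ≤ t₁) (h12 : t₁ ≤ t₂) (ht₂ : t₂ ≤ T) :
    Real.sqrt (∫ x, θ t₂ x ^ 2) ≤
      Real.sqrt (∫ x, θ t₁ x ^ 2) + ∫ τ in Ioo t₁ t₂, Real.sqrt (∫ x, s τ x ^ 2) := by
  -- the data of the comparison lemma on `[t₁, T]`
  have hgT : IntegrableOn (fun τ => Real.sqrt (∫ x, s τ x ^ 2)) (Icc t₁ T) volume := by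
    refine (h.integrableOn_sqrt_integral_sq_source hs).mono_set_ae ?_
    have h1 : (Icc t₁ T : Set ℝ) ≤ᵐ[volume] (Icc 0 T : Set ℝ) := (Icc_subset_Icc ht₁ le_rfl).eventuallyLE
    exact h1.trans (Ioo_ae_eq_Icc (μ := (volume : Measure ℝ)) (a := (0 : ℝ)) (b := T)).symm.le
  have hE : ContinuousOn (fun t => ∫ x, θ t x ^ 2) (Icc t₁ T) :=
    hc.continuousOn_integral_sq.mono (Icc_subset_Icc ht₁ le_rfl)
  have hCS : ∀ᵐ τ ∂(volume.restrict (Ioo 0 T)),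
      ∫ x, s τ x * θ τ x ≤ Real.sqrt (∫ x, s τ x ^ 2) * Real.sqrt (∫ x, θ τ x ^ 2) := by
    filter_upwards [h.ae_memLp_two_source hs, ae_restrict_mem measurableSet_Ioo] with τ hsm hτ
    exact (le_abs_self _).trans (cs_abs_integral_mul_le hsm (hc.memLp ⟨hτ.1.le, hτ.2.le⟩))
  have hineq : ∀ ⦃a' b' : ℝ⦄, t₁ ≤ a' → a' ≤ b' → b' ≤ T →
      (∫ x, θ b' x ^ 2) ≤ (∫ x, θ a' x ^ 2) +
        2 * ∫ τ in Ioc a' b', Real.sqrt (∫ x, s τ x ^ 2) * Real.sqrt (∫ x, θ τ x ^ 2) := by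
    intro a' b' ha' hab hb'
    have hE2 := h.energy_eq_sub_of_isL2ContinuousOn hT hκ ha hθ₀ hu hs hc (ht₁.trans ha') hab hb'
    have hD : 0 ≤ 2 * κ * (∫⁻ τ in Ioo a' b', Torus.eScalarGradNormSqDiag a (θ τ)).toReal := by positivity
    have hsub : Ioo a' b' ⊆ Ioo 0 T := fun τ hτ => ⟨(ht₁.trans ha').trans_lt hτ.1, hτ.2.trans_le hb'⟩
    have hmono : ∫ τ in Ioo a' b', ∫ x, s τ x * θ τ x ≤
        ∫ τ in Ioo a' b', Real.sqrt (∫ x, s τ x ^ 2) * Real.sqrt (∫ x, θ τ x ^ 2) := by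
      refine integral_mono_ae ((h.integrableOn_integral_source_mul hs).mono_set hsub) ?_
        (ae_restrict_of_ae_restrict_of_subset hsub hCS)
      exact (hgT.mono_set (Ioo_subset_Icc_self.trans (Icc_subset_Icc ha' hb'))).mul_continuousOn_of_subset
        (Real.continuous_sqrt.comp_continuousOn (hE.mono (Icc_subset_Icc ha' hb')))
        measurableSet_Ioo isCompact_Icc Ioo_subset_Icc_self
    rw [setIntegral_congr_set (Ioo_ae_eq_Ioc (μ := (volume : Measure ℝ)) (a := a') (b := b')),
      setIntegral_congr_set (Ioo_ae_eq_Ioc (μ := (volume : Measure ℝ)) (a := a') (b := b'))] at hmono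
    rw [setIntegral_congr_set (Ioo_ae_eq_Ioc (μ := (volume : Measure ℝ)) (a := a') (b := b'))] at hE2
    linarith [hE2, hD, hmono]
  have key := sqrt_le_sqrt_add_integral hE (fun t _ => integral_nonneg fun x => sq_nonneg _) hgT
    (fun τ => Real.sqrt_nonneg _) hineq t₂ ⟨h12, ht₂⟩
  rwa [← setIntegral_congr_set (Ioo_ae_eq_Ioc (μ := (volume : Measure ℝ)) (a := t₁) (b := t₂))] at key

/-- **Datum form of the Duhamel bound**: `‖θ(t)‖_{L²} ≤ ‖θ₀‖_{L²} + ∫₀ᵗ ‖s(τ)‖_{L²} dτ` for every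
`t ∈ [0,T]` and every `L²`-continuous weak solution (`θ(0) = θ₀` a.e.).
[cite: Pazy1983, Ch. 4 §4.2 (2.3) and Cor. 2.2] -/
theorem sqrt_integral_sq_le_datum_of_isL2ContinuousOn (h : IsWeakScalarTransportDiagForcedOn T a κ u s θ₀ θ)
    (hT : 0 < T) (hκ : 0 < κ) (ha : ∀ i, 0 < a i) (hθ₀ : MemLp θ₀ 2 volume)
    (hu : MemLp (stLift u) ⊤ (volume.restrict (Ioo 0 T ×ˢ univ)))
    (hs : ∫⁻ t in Ioo 0 T, (∫⁻ x, ‖s t x‖ₑ ^ 2) ^ (1 / 2 : ℝ) < ⊤) (hc : IsL2ContinuousOn (Icc 0 T) θ)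
    {t : ℝ} (ht : t ∈ Icc 0 T) :
    Real.sqrt (∫ x, θ t x ^ 2) ≤ Real.sqrt (∫ x, θ₀ x ^ 2) + ∫ τ in Ioo 0 t, Real.sqrt (∫ x, s τ x ^ 2) := by
  have key := h.sqrt_integral_sq_le_of_isL2ContinuousOn hT hκ ha hθ₀ hu hs hc le_rfl ht.1 ht.2
  have hz : ∫ x, θ 0 x ^ 2 = ∫ x, θ₀ x ^ 2 :=
    integral_congr_ae ((h.zero_ae_eq_of_isL2ContinuousOn hT hθ₀ hc).mono fun x hx => by simp only [hx])
  rwa [hz] at key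

end IsWeakScalarTransportDiagForcedOn

namespace IsWeakScalarTransportDiagForced

variable {κ : ℝ} {a : d → ℝ} {u : ℝ → UnitAddTorus d → EuclideanSpace ℝ d} {s : ℝ → UnitAddTorus d → ℝ}
  {θ₀ : UnitAddTorus d → ℝ} {θ : ℝ → UnitAddTorus d → ℝ}

/-! ## The Duhamel bound for global solutions -/

/-- **`L¹_t L²_x` source bound (Duhamel) for global `C([0,∞); L²)` weak passive scalars**: for
all `0 ≤ t₁ ≤ t₂`, `‖θ(t₂)‖_{L²} ≤ ‖θ(t₁)‖_{L²} + ∫_{t₁}^{t₂} ‖s(τ)‖_{L²} dτ` (horizon `t₂ + 1`).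
[cite: Pazy1983, Ch. 4 §4.2 (2.3) and Cor. 2.2] -/
theorem sqrt_integral_sq_le_of_isL2ContinuousOn (h : IsWeakScalarTransportDiagForced a κ u s θ₀ θ)
    (hκ : 0 < κ) (ha : ∀ i, 0 < a i) (hθ₀ : MemLp θ₀ 2 volume)
    (hu : ∀ T : ℝ, 0 < T → MemLp (stLift u) ⊤ (volume.restrict (Ioo 0 T ×ˢ univ)))
    (hs : ∀ T : ℝ, 0 < T → ∫⁻ t in Ioo 0 T, (∫⁻ x, ‖s t x‖ₑ ^ 2) ^ (1 / 2 : ℝ) < ⊤)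
    (hc : IsL2ContinuousOn (Ici 0) θ) {t₁ t₂ : ℝ} (ht₁ : 0 ≤ t₁) (h12 : t₁ ≤ t₂) :
    Real.sqrt (∫ x, θ t₂ x ^ 2) ≤
      Real.sqrt (∫ x, θ t₁ x ^ 2) + ∫ τ in Ioo t₁ t₂, Real.sqrt (∫ x, s τ x ^ 2) := by
  have hT : 0 < t₂ + 1 := by linarith
  exact (h (t₂ + 1) hT).sqrt_integral_sq_le_of_isL2ContinuousOn hT hκ ha hθ₀ (hu _ hT) (hs _ hT)
    (hc.mono Icc_subset_Ici_self) ht₁ h12 (by linarith)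

/-- **Datum form, global**: `‖θ(t)‖_{L²} ≤ ‖θ₀‖_{L²} + ∫₀ᵗ ‖s(τ)‖_{L²} dτ` for every `t ≥ 0` and
every global `C([0,∞); L²)` weak solution. [cite: Pazy1983, Ch. 4 §4.2 (2.3) and Cor. 2.2] -/
theorem sqrt_integral_sq_le_datum_of_isL2ContinuousOn (h : IsWeakScalarTransportDiagForced a κ u s θ₀ θ)
    (hκ : 0 < κ) (ha : ∀ i, 0 < a i) (hθ₀ : MemLp θ₀ 2 volume)
    (hu : ∀ T : ℝ, 0 < T → MemLp (stLift u) ⊤ (volume.restrict (Ioo 0 T ×ˢ univ)))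
    (hs : ∀ T : ℝ, 0 < T → ∫⁻ t in Ioo 0 T, (∫⁻ x, ‖s t x‖ₑ ^ 2) ^ (1 / 2 : ℝ) < ⊤)
    (hc : IsL2ContinuousOn (Ici 0) θ) {t : ℝ} (ht : 0 ≤ t) :
    Real.sqrt (∫ x, θ t x ^ 2) ≤ Real.sqrt (∫ x, θ₀ x ^ 2) + ∫ τ in Ioo 0 t, Real.sqrt (∫ x, s τ x ^ 2) := by
  have hT : 0 < t + 1 := by linarith
  exact (h (t + 1) hT).sqrt_integral_sq_le_datum_of_isL2ContinuousOn hT hκ ha hθ₀ (hu _ hT) (hs _ hT)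
    (hc.mono Icc_subset_Ici_self) ⟨ht, by linarith⟩

end IsWeakScalarTransportDiagForced

end Torus

end Literature.Analysis.FluidPDE

end
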